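import Mathlib.NumberTheory.NumberField.Basic
import Mathlib.RingTheory.RamificationInertia.Inertia
import Mathlib.NumberTheory.RamificationInertia.Galois
import Mathlib.RingTheory.DedekindDomain.AdicValuation
import Mathlib.RingTheory.DedekindDomain.Ideal.Lemmas
import Mathlib.RingTheory.Ideal.Pointwise
import Mathlib.RingTheory.Ideal.Over
import Mathlib.Topology.Algebra.UniformRing
import HarnessLib

/-!
# Galois action on finite places and on adic completions

Topic `NumberTheory/Automorphic` (infrastructure for base change, Arthur–Clozel Ch. 3: the
`Gal(E/F)`-conjugate `Π^σ` of an automorphic representation of `GL_n(𝔸_E)` and "`σ`-stable"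
representations); namespace `Literature.Automorphic`.

For a Dedekind domain `B` with fraction field `L` and a group `G` acting on `B` and `L` by ring
automorphisms compatibly (`[MulSemiringAction G B] [MulSemiringAction G L] [SMulDistribClass G B L]`;
the case in point is `G = E ≃ₐ[F] E`, `B = 𝓞 E`, `L = E`, all instances being Mathlib's), this
file constructs — everything **proved**, no named facts —

* the action of `G` on the finite places `HeightOneSpectrum B` (`g • w` has prime `g • 𝔭_w`;
  a `MulAction` instance `instMulActionHeightOneSpectrum`, the `HeightOneSpectrum` analogue of
  Mathlib's `MulAction G (primesOver p B)` of `Mathlib.NumberTheory.RamificationInertia.Galois`),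
  with `under_smul` (conjugate places lie over the same place of the invariants),
  `inertiaDeg_smul`, `card_quotient_smul` / `absNorm_algEquiv_smul` (same residue cardinality),
  `count_smul_asIdeal` (`ord_{g w}(g I) = ord_w(I)`), and transitivity on fibres for Galois
  `E/F` (`exists_algEquiv_smul_eq`, from Mathlib's `Ideal.exists_smul_eq_of_isGaloisGroup`;
  Cassels–Fröhlich VII Prop. 1.2 (ii));
* Galois-equivariance of the valuations: `intValuation_smul`, `valuation_smul`
  (`v_{g w}(g x) = v_w(x)`; Cassels–Fröhlich, Ch. VII §1.1: `|a|_{σ w} = |σ⁻¹ a|_w`);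
* the **transport of completions** `galAdicCompletionMap g h : L_w →+* L_{w'}` for
  `h : g • w = w'`, the continuous extension of `x ↦ g • x` (Mathlib
  `UniformSpace.Completion.mapRingHom`; uniform continuity from the equivariance of valuations,
  `uniformContinuous_of_map_valuation_eq`), with: extension of `g` (`galAdicCompletionMap_coe`),
  continuity, preservation of the valuation (`valued_galAdicCompletionMap`, by density and local
  constancy of the valuation) hence of the integers (`σ 𝔒_w = 𝔒_{σ w}`), the cocycle law
  `σ_{τ w} ∘ τ_w = (σ τ)_w` (`galAdicCompletionMap_galAdicCompletionMap`) and `1_w = id`, the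
  packaging as a ring isomorphism / homeomorphism / isomorphism of unit groups
  (`galAdicCompletionEquiv`, `galAdicCompletionHomeomorph`, `galAdicCompletionUnitsEquiv`), and,
  for `G = E ≃ₐ[F] E`, `K_v`-linearity in the form `galAdicCompletionMap_algebraMap`
  (Cassels–Fröhlich, Ch. VII §1.1: "`σ` induces by continuity an isomorphism
  `σ_w : L_w → L_{σ w}` …; if `w` is over `v` so is `σ w` and this map is a `K_v`-isomorphism;
  `σ_{τ w} ∘ τ_w = (σ τ)_w`").

Design notes.
* The data of `galAdicCompletionMap g h` do not depend on the proof `h : g • w = w'`; keeping the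
  target place `w'` a free variable (rather than the term `g • w`) avoids transport along
  equalities of places in the restricted product over `w` (finite adeles, next file):
  the component at `w` of `g • x` is `galAdicCompletionMap g (smul_inv_smul g w) (x (g⁻¹ • w))`.
  `galAdicCompletionMap_congr_left` / `galAdicCompletionMap_apply_congr_place` are the two
  proof-irrelevance / `subst` lemmas this requires.
* New instances: `instMulActionHeightOneSpectrum` (no Mathlib instance of this type exists in the
  pin) and the `Prop`-valued `instSMulCommClassAlgEquivRingOfIntegers :
  SMulCommClass (E ≃ₐ[F] E) (𝓞 F) (𝓞 E)` (needed by Mathlib's `Ideal.under_smul`,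
  `Ideal.inertiaDeg_smul`, `Ideal.exists_smul_eq_of_isGaloisGroup`); neither overrides or
  duplicates a Mathlib instance. Lemmas named `HeightOneSpectrum.*`, `RingOfIntegers.*`,
  `Ideal.*`, `WithZero.*` live in `Literature.Automorphic.*` (no Mathlib namespace is entered).
* No `sorry`, no named facts.

## References

* J. W. S. Cassels, A. Fröhlich (eds.), *Algebraic Number Theory* (1967), Ch. VII (J. Tate,
  *Global class field theory*), §1.1 "Action of the Galois group on primes and completions".
  [CasselsFrohlichANT1967]
  Also Prop. 1.2 (ii) there (transitivity of `G` on the primes above `v`). [CasselsFrohlichANT1967]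
* J. Neukirch, *Algebraic Number Theory* (1999), Ch. II §8–§9 (extensions of valuations,
  conjugate primes) — background only. [NeukirchANT1999]
-/

noncomputable section

open IsDedekindDomain MonoidWithZeroHom MonoidWithZeroHom.ValueGroup₀ WithZero
open scoped Pointwise

namespace Literature.NumberTheory.Automorphic

/-! ### The action on `HeightOneSpectrum B` -/

section Places

variable {B : Type*} [CommRing B] [IsDedekindDomain B] {G : Type*} [Group G] [MulSemiringAction G B]

/-- A group acting on a Dedekind domain `B` by ring automorphisms acts on its non-zero primes:
`g • w` is the prime `g • 𝔭_w = g(𝔭_w)`. [folklore] -/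
instance instMulActionHeightOneSpectrum : MulAction G (HeightOneSpectrum B) where
  smul g w :=
    { asIdeal := g • w.asIdeal
      isPrime := inferInstance
      ne_bot := fun h => w.ne_bot (by simpa using congrArg (g⁻¹ • ·) h) }
  one_smul w := HeightOneSpectrum.ext (one_smul G w.asIdeal)
  mul_smul g h w := HeightOneSpectrum.ext (mul_smul g h w.asIdeal)

omit [IsDedekindDomain B] in
/-- The prime of `g • w` is `g • 𝔭_w` (definitional). [folklore] -/
@[simp] theorem HeightOneSpectrum.smul_asIdeal (g : G) (w : HeightOneSpectrum B) :
    (g • w).asIdeal = g • w.asIdeal := rfl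

omit [IsDedekindDomain B] in
/-- `g • x ∈ 𝔭_{g • w} ↔ x ∈ 𝔭_w`. [folklore] -/
theorem HeightOneSpectrum.smul_mem_smul_asIdeal_iff (g : G) (w : HeightOneSpectrum B) (x : B) :
    g • x ∈ (g • w).asIdeal ↔ x ∈ w.asIdeal :=
  Ideal.smul_mem_pointwise_smul_iff

/-- An element of `ℤₘ₀` bounded by `1` is below another one as soon as every bound
`exp (-n)`, `n : ℕ`, of the latter also bounds the former. [folklore] -/
theorem WithZero.le_of_forall_le_exp_neg {a b : ℤᵐ⁰} (hb : b ≤ 1)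
    (h : ∀ n : ℕ, b ≤ exp (-(n : ℤ)) → a ≤ exp (-(n : ℤ))) : a ≤ b := by
  rcases eq_or_ne b 0 with rfl | hb0
  · -- `a ≤ exp (-n)` for all `n` forces `a = 0`
    rcases eq_or_ne a 0 with rfl | ha0
    · exact le_rfl
    · have ha : ∀ n : ℕ, a ≤ exp (-(n : ℤ)) := fun n => h n zero_le
      obtain ⟨z, rfl⟩ : ∃ z : ℤ, a = exp z := ⟨log a, (exp_log ha0).symm⟩
      have := ha (Int.toNat (-z) + 1)
      rw [exp_le_exp] at this
      omega
  · obtain ⟨z, rfl⟩ : ∃ z : ℤ, b = exp z := ⟨log b, (exp_log hb0).symm⟩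
    have hz : z ≤ 0 := by rwa [← exp_zero, exp_le_exp] at hb
    have := h (Int.toNat (-z)) (by rw [exp_le_exp]; omega)
    rwa [show (-(Int.toNat (-z) : ℤ)) = z by omega] at this

/-- Two elements of `ℤₘ₀` bounded by `1` with the same bounds `exp (-n)`, `n : ℕ`, are equal.
[folklore] -/
theorem WithZero.eq_of_forall_le_exp_neg_iff {a b : ℤᵐ⁰} (ha : a ≤ 1) (hb : b ≤ 1)
    (h : ∀ n : ℕ, a ≤ exp (-(n : ℤ)) ↔ b ≤ exp (-(n : ℤ))) : a = b :=
  le_antisymm (WithZero.le_of_forall_le_exp_neg hb fun n => (h n).mpr)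
    (WithZero.le_of_forall_le_exp_neg ha fun n => (h n).mp)

/-- **The `𝔭`-adic valuation is Galois-equivariant**: `v_{g • w}(g • x) = v_w(x)` on `B`
(both are characterised by `v(x) ≤ exp (-n) ↔ x ∈ 𝔭ⁿ`, and `g • 𝔭_wⁿ = 𝔭_{g•w}ⁿ`);
Cassels–Fröhlich VII §1.1: `|a|_{σ w} = |σ⁻¹ a|_w`. [cite: CasselsFrohlichANT1967, Ch. VII §1.1] -/
theorem HeightOneSpectrum.intValuation_smul (g : G) (w : HeightOneSpectrum B) (x : B) :
    (g • w).intValuation (g • x) = w.intValuation x := by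
  refine WithZero.eq_of_forall_le_exp_neg_iff (HeightOneSpectrum.intValuation_le_one _ _)
    (HeightOneSpectrum.intValuation_le_one _ _) fun n => ?_
  rw [HeightOneSpectrum.intValuation_le_pow_iff_mem, HeightOneSpectrum.intValuation_le_pow_iff_mem,
    HeightOneSpectrum.smul_asIdeal, ← smul_pow', Ideal.smul_mem_pointwise_smul_iff]

section Under

variable (A : Type*) [CommRing A] [IsDedekindDomain A] [Algebra A B] [Algebra.IsIntegral A B]
  [SMulCommClass G A B]

/-- A Galois conjugate prime lies over the same prime of the base: `(g • w) ∩ A = w ∩ A`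
(Mathlib `Ideal.under_smul`). [folklore] -/
@[simp] theorem HeightOneSpectrum.under_smul (g : G) (w : HeightOneSpectrum B) :
    (g • w).under A = w.under A :=
  HeightOneSpectrum.ext (Ideal.under_smul A w.asIdeal g)

omit [IsDedekindDomain B] [IsDedekindDomain A] [Algebra.IsIntegral A B] in
/-- Conjugate primes have the same residue degree over the base (Mathlib `Ideal.inertiaDeg_smul`).
[folklore] -/
@[simp] theorem HeightOneSpectrum.inertiaDeg_smul (g : G) (w : HeightOneSpectrum B) :
    (g • w).asIdeal.inertiaDeg A = w.asIdeal.inertiaDeg A :=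
  Ideal.inertiaDeg_smul A w.asIdeal g

end Under

omit [IsDedekindDomain B] in
/-- The residue rings of conjugate primes are isomorphic (along `g`). [folklore] -/
def HeightOneSpectrum.residueEquivOfSMul (g : G) (w : HeightOneSpectrum B) :
    B ⧸ w.asIdeal ≃+* B ⧸ (g • w).asIdeal :=
  Ideal.quotientEquiv w.asIdeal (g • w).asIdeal (MulSemiringAction.toRingEquiv G B g)
    (by rw [HeightOneSpectrum.smul_asIdeal, Ideal.pointwise_smul_def]; rfl)

omit [IsDedekindDomain B] in
/-- Conjugate primes have residue rings of the same cardinality. [folklore] -/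
@[simp] theorem HeightOneSpectrum.card_quotient_smul (g : G) (w : HeightOneSpectrum B) :
    Nat.card (B ⧸ (g • w).asIdeal) = Nat.card (B ⧸ w.asIdeal) :=
  (Nat.card_congr (HeightOneSpectrum.residueEquivOfSMul g w).toEquiv).symm

/-- `𝔭_{g w}ⁿ ∣ g • I ↔ 𝔭_wⁿ ∣ I`: the action preserves divisibility of ideals. [folklore] -/
theorem HeightOneSpectrum.smul_asIdeal_pow_dvd_smul_iff (g : G) (w : HeightOneSpectrum B)
    (I : Ideal B) (n : ℕ) : (g • w).asIdeal ^ n ∣ g • I ↔ w.asIdeal ^ n ∣ I := by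
  rw [Ideal.dvd_iff_le, Ideal.dvd_iff_le, HeightOneSpectrum.smul_asIdeal, ← smul_pow',
    Ideal.pointwise_smul_le_pointwise_smul_iff]

omit [IsDedekindDomain B] in
/-- `g • I = 0 ↔ I = 0` for ideals. [folklore] -/
theorem Ideal.smul_eq_bot_iff (g : G) (I : Ideal B) : g • I = ⊥ ↔ I = ⊥ := by
  constructor
  · intro h
    simpa using congrArg (g⁻¹ • ·) h
  · rintro rfl
    exact Ideal.smul_bot g

open scoped Classical in
/-- **The exponent of `𝔭` in an ideal is Galois-invariant**: `ord_{g w}(g • I) = ord_w(I)`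
(as `Associates.count` in the factorisation, the form used by `FractionalIdeal.count`). [folklore] -/
theorem HeightOneSpectrum.count_smul_asIdeal (g : G) (w : HeightOneSpectrum B) {I : Ideal B}
    (hI : I ≠ ⊥) :
    (Associates.mk (g • w).asIdeal).count (Associates.mk (g • I)).factors =
      (Associates.mk w.asIdeal).count (Associates.mk I).factors := by
  have hgI : g • I ≠ ⊥ := fun h => hI ((Ideal.smul_eq_bot_iff g I).mp h)
  have key : ∀ k : ℕ, k ≤ (Associates.mk (g • w).asIdeal).count (Associates.mk (g • I)).factors ↔
      k ≤ (Associates.mk w.asIdeal).count (Associates.mk I).factors := fun k => by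
    rw [← Associates.prime_pow_dvd_iff_le (Associates.mk_ne_zero.mpr hgI) (g • w).associates_irreducible,
      ← Associates.prime_pow_dvd_iff_le (Associates.mk_ne_zero.mpr hI) w.associates_irreducible,
      ← Associates.mk_pow, ← Associates.mk_pow, Associates.mk_le_mk_iff_dvd,
      Associates.mk_le_mk_iff_dvd, HeightOneSpectrum.smul_asIdeal_pow_dvd_smul_iff]
  exact le_antisymm ((key _).mp le_rfl) ((key _).mpr le_rfl)

end Places

/-! ### The action on the valuation of the fraction field -/

section FractionField

variable {B : Type*} [CommRing B] [IsDedekindDomain B] {G : Type*} [Group G] [MulSemiringAction G B]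
variable (L : Type*) [Field L] [Algebra B L] [IsFractionRing B L] [MulSemiringAction G L]
  [SMulDistribClass G B L]

omit [IsDedekindDomain B] [IsFractionRing B L] in
/-- Compatibility of the actions on `B` and on its fraction field: `g • b = g • (b : L)`.
[folklore] -/
theorem smul_algebraMap_eq (g : G) (b : B) : g • algebraMap B L b = algebraMap B L (g • b) := by
  rw [Algebra.algebraMap_eq_smul_one, Algebra.algebraMap_eq_smul_one, smul_distrib_smul, smul_one]

/-- **The `𝔭`-adic valuation of the fraction field is Galois-equivariant**:
`v_{g • w}(g • x) = v_w(x)` for `x ∈ L = Frac B` (Cassels–Fröhlich VII §1.1: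
`|a|_{σ w} = |σ⁻¹ a|_w`). [cite: CasselsFrohlichANT1967, Ch. VII §1.1] -/
theorem HeightOneSpectrum.valuation_smul (g : G) (w : HeightOneSpectrum B) (x : L) :
    (g • w).valuation L (g • x) = w.valuation L x := by
  obtain ⟨a, b, hb, rfl⟩ := IsFractionRing.div_surjective (A := B) x
  rw [smul_div₀' , smul_algebraMap_eq, smul_algebraMap_eq, map_div₀, map_div₀,
    HeightOneSpectrum.valuation_of_algebraMap, HeightOneSpectrum.valuation_of_algebraMap,
    HeightOneSpectrum.valuation_of_algebraMap, HeightOneSpectrum.valuation_of_algebraMap,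
    HeightOneSpectrum.intValuation_smul, HeightOneSpectrum.intValuation_smul]

end FractionField

/-! ### Transport of adic completions along the action -/

section Completion

variable {B : Type*} [CommRing B] [IsDedekindDomain B] {G : Type*} [Group G] [MulSemiringAction G B]
variable (L : Type*) [Field L] [Algebra B L] [IsFractionRing B L] [MulSemiringAction G L]
  [SMulDistribClass G B L]

/-- A ring homomorphism between valued rings (same value group) preserving the valuations is
uniformly continuous, provided the valuation of the source is surjective (so that every ball of
the target pulls back to a ball of the source). [folklore] -/
theorem uniformContinuous_of_map_valuation_eq {R S Γ₀ : Type*} [Ring R] [Ring S]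
    [LinearOrderedCommGroupWithZero Γ₀] [hR : Valued R Γ₀] [hS : Valued S Γ₀] (f : R →+* S)
    (hf : ∀ x, Valued.v (f x) = Valued.v x) (hsurj : Function.Surjective (Valued.v : R → Γ₀)) :
    UniformContinuous f := by
  refine uniformContinuous_of_continuousAt_zero f ?_
  rw [ContinuousAt, map_zero, (Valued.hasBasis_nhds_zero R Γ₀).tendsto_iff
    (Valued.hasBasis_nhds_zero S Γ₀)]
  rintro γ -
  obtain ⟨x₀, hx₀⟩ := hsurj (embedding (γ : ValueGroup₀ (.ofClass hS.v)))
  have hx₀' : Valued.v.restrict x₀ ≠ 0 := by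
    rw [Ne, Valuation.restrict_eq_zero_iff, hx₀, map_eq_zero_iff _ embedding_injective]
    exact γ.ne_zero
  refine ⟨Units.mk0 _ hx₀', trivial, fun x hx => ?_⟩
  simp only [Set.mem_setOf_eq, Units.val_mk0, Valuation.restrict_lt_iff] at hx
  simp only [Set.mem_setOf_eq, Valuation.restrict_lt_iff_lt_embedding, hf, ← hx₀]
  exact hx

variable {L} in
/-- The automorphism `g` of `L` as a ring homomorphism `WithVal v_w → WithVal v_{w'}` between the
valued copies of `L` at two finite places. [folklore] -/
def galWithValMap (g : G) (w w' : HeightOneSpectrum B) :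
    WithVal (w.valuation L) →+* WithVal (w'.valuation L) :=
  WithVal.map _ _ (MulSemiringAction.toRingHom G L g)

omit [MulSemiringAction G B] [SMulDistribClass G B L] in
/-- `galWithValMap g w w' x = g • x` on underlying elements (definitional). [folklore] -/
@[simp] theorem galWithValMap_apply (g : G) (w w' : HeightOneSpectrum B)
    (x : WithVal (w.valuation L)) :
    galWithValMap (L := L) g w w' x = WithVal.toVal (w'.valuation L) (g • x.ofVal) := rfl

/-- For `w' = g • w` the map `g : WithVal v_w → WithVal v_{w'}` preserves the valuations. [folklore] -/
theorem valued_galWithValMap {g : G} {w w' : HeightOneSpectrum B} (h : g • w = w')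
    (x : WithVal (w.valuation L)) : Valued.v (galWithValMap (L := L) g w w' x) = Valued.v x := by
  subst h
  rw [galWithValMap_apply, WithVal.valued_toVal, ← WithVal.apply_ofVal, HeightOneSpectrum.valuation_smul]

/-- For `w' = g • w` the map `g : WithVal v_w → WithVal v_{w'}` is uniformly continuous. [folklore] -/
theorem uniformContinuous_galWithValMap {g : G} {w w' : HeightOneSpectrum B} (h : g • w = w') :
    UniformContinuous (galWithValMap (L := L) g w w') :=
  uniformContinuous_of_map_valuation_eq _ (valued_galWithValMap L h) fun γ => by
    obtain ⟨x, hx⟩ := HeightOneSpectrum.valuation_surjective L w γ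
    exact ⟨WithVal.toVal _ x, by simpa using hx⟩

variable {L} in
/-- **Galois transport of completions.** For `g ∈ G` and finite places `w, w'` of `L = Frac B`
with `g • w = w'`, the continuous extension `L_w →+* L_{w'}` of `x ↦ g • x` (Mathlib
`UniformSpace.Completion.mapRingHom` of the uniformly continuous `galWithValMap`). The data do not
depend on the proof `h`. [cite: CasselsFrohlichANT1967, Ch. VII §1.1] -/
def galAdicCompletionMap (g : G) {w w' : HeightOneSpectrum B} (h : g • w = w') :
    w.adicCompletion L →+* w'.adicCompletion L :=
  (HeightOneSpectrum.adicCompletion.equiv L w').symm.toRingHom.comp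
    ((UniformSpace.Completion.mapRingHom (galWithValMap (L := L) g w w')
        (uniformContinuous_galWithValMap L h).continuous).comp
      (HeightOneSpectrum.adicCompletion.equiv L w).toRingHom)

/-- `galAdicCompletionMap` extends `x ↦ g • x`: on `x ∈ L` it is `g • x`. [folklore] -/
@[simp] theorem galAdicCompletionMap_coe (g : G) {w w' : HeightOneSpectrum B} (h : g • w = w')
    (x : L) : galAdicCompletionMap g h (x : w.adicCompletion L) = ((g • x : L) : w'.adicCompletion L) := by
  apply HeightOneSpectrum.adicCompletion.ext
  simp only [galAdicCompletionMap, RingHom.coe_comp, RingEquiv.toRingHom_eq_coe, RingHom.coe_coe,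
    Function.comp_apply, HeightOneSpectrum.adicCompletion.equiv_apply]
  change (HeightOneSpectrum.adicCompletion.ofCompletion _).toCompletion = _
  rw [HeightOneSpectrum.adicCompletion.toCompletion_ofCompletion]
  change UniformSpace.Completion.mapRingHom _ _
    ((WithVal.toVal (w.valuation L) x : WithVal (w.valuation L)) : (w.valuation L).Completion) =
    ((WithVal.toVal (w'.valuation L) (g • x) : WithVal (w'.valuation L)) :
      (w'.valuation L).Completion)
  rw [UniformSpace.Completion.mapRingHom_coe]
  rfl

/-- `galAdicCompletionMap` is continuous. [folklore] -/
theorem continuous_galAdicCompletionMap (g : G) {w w' : HeightOneSpectrum B} (h : g • w = w') :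
    Continuous (galAdicCompletionMap (L := L) g h) :=
  (HeightOneSpectrum.adicCompletion.continuous_ofCompletion L w').comp
    (UniformSpace.Completion.continuous_map.comp
      (HeightOneSpectrum.adicCompletion.continuous_toCompletion L w))

/-- Two continuous maps out of `L_w` that agree on `L` are equal (`L` is dense in `L_w`). [folklore] -/
theorem HeightOneSpectrum.adicCompletion.ext_of_coe {X : Type*} [TopologicalSpace X] [T2Space X]
    (w : HeightOneSpectrum B) {f f' : w.adicCompletion L → X} (hf : Continuous f)
    (hf' : Continuous f') (h : ∀ x : L, f x = f' x) : f = f' :=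
  (HeightOneSpectrum.denseRange_algebraMap (K := L) (v := w)).equalizer hf hf' (funext fun x => h x)

/-- **`galAdicCompletionMap` preserves the valuations**: `v_{w'}(g y) = v_w(y)` on `L_w`
(the valuation is locally constant off `0`, `L` is dense, and the identity holds on `L`); in
particular `σ 𝔒_w = 𝔒_{σ w}`. [cite: CasselsFrohlichANT1967, Ch. VII §1.1] -/
@[simp] theorem valued_galAdicCompletionMap (g : G) {w w' : HeightOneSpectrum B} (h : g • w = w')
    (y : w.adicCompletion L) : Valued.v (galAdicCompletionMap g h y) = Valued.v y := by
  rcases eq_or_ne y 0 with rfl | hy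
  · simp
  · have hy' : galAdicCompletionMap (L := L) g h y ≠ 0 :=
      (map_ne_zero_iff _ (galAdicCompletionMap g h).injective).mpr hy
    have h1 : {z : w.adicCompletion L | Valued.v z = Valued.v y} ∈ nhds y :=
      Valued.locally_const ((Valuation.ne_zero_iff _).mpr hy)
    have h2 : galAdicCompletionMap (L := L) g h ⁻¹'
        {z : w'.adicCompletion L | Valued.v z = Valued.v (galAdicCompletionMap (L := L) g h y)} ∈
          nhds y :=
      (continuous_galAdicCompletionMap L g h).continuousAt.preimage_mem_nhds
        (Valued.locally_const ((Valuation.ne_zero_iff _).mpr hy'))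
    obtain ⟨x, hx1, hx2⟩ :=
      (HeightOneSpectrum.denseRange_algebraMap (K := L) (v := w)).mem_nhds (Filter.inter_mem h1 h2)
    simp only [Set.mem_setOf_eq, Set.mem_preimage] at hx1 hx2
    rw [← hx2, ← hx1]
    change Valued.v (galAdicCompletionMap g h (x : w.adicCompletion L)) =
      Valued.v ((x : L) : w.adicCompletion L)
    subst h
    rw [galAdicCompletionMap_coe, HeightOneSpectrum.adicCompletion.valued_coe,
      HeightOneSpectrum.adicCompletion.valued_coe, HeightOneSpectrum.valuation_smul]

/-- `galAdicCompletionMap` respects integrality: `g y ∈ 𝒪_{w'} ↔ y ∈ 𝒪_w`. [folklore] -/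
theorem galAdicCompletionMap_mem_adicCompletionIntegers_iff (g : G) {w w' : HeightOneSpectrum B}
    (h : g • w = w') (y : w.adicCompletion L) :
    galAdicCompletionMap g h y ∈ w'.adicCompletionIntegers L ↔ y ∈ w.adicCompletionIntegers L := by
  rw [HeightOneSpectrum.mem_adicCompletionIntegers, HeightOneSpectrum.mem_adicCompletionIntegers,
    valued_galAdicCompletionMap]

/-- **Cocycle law** `σ_{τ w} ∘ τ_w = (σ τ)_w`: `(g' g)` on completions is the composite of `g`
and `g'` (`L_w → L_{g w} → L_{g' g w}`); by density of `L` and continuity.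
[cite: CasselsFrohlichANT1967, Ch. VII §1.1] -/
theorem galAdicCompletionMap_galAdicCompletionMap (g g' : G) {w w' w'' : HeightOneSpectrum B}
    (h : g • w = w') (h' : g' • w' = w'') (y : w.adicCompletion L) :
    galAdicCompletionMap g' h' (galAdicCompletionMap g h y) =
      galAdicCompletionMap (g' * g) ((mul_smul g' g w).trans (by rw [h, h'])) y := by
  refine congrFun (HeightOneSpectrum.adicCompletion.ext_of_coe L w
    ((continuous_galAdicCompletionMap L g' h').comp (continuous_galAdicCompletionMap L g h))
    (continuous_galAdicCompletionMap L (g' * g) _) fun x => ?_) y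
  simp only [Function.comp_apply, galAdicCompletionMap_coe, mul_smul]

/-- The identity of `G` acts as the identity on `L_w`. [folklore] -/
@[simp] theorem galAdicCompletionMap_one {w : HeightOneSpectrum B} (h : (1 : G) • w = w)
    (y : w.adicCompletion L) : galAdicCompletionMap (L := L) 1 h y = y := by
  refine congrFun (HeightOneSpectrum.adicCompletion.ext_of_coe L w
    (continuous_galAdicCompletionMap L 1 h) continuous_id fun x => ?_) y
  simp only [galAdicCompletionMap_coe, one_smul, id_eq]

/-- `galAdicCompletionMap g h` only depends on `g` (and the places), not on the way `g` or the
proof `h` are written. [folklore] -/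
theorem galAdicCompletionMap_congr_left {g₁ g₂ : G} (hg : g₁ = g₂) {w w' : HeightOneSpectrum B}
    (h₁ : g₁ • w = w') (h₂ : g₂ • w = w') (y : w.adicCompletion L) :
    galAdicCompletionMap (L := L) g₁ h₁ y = galAdicCompletionMap g₂ h₂ y := by
  subst hg; rfl

/-- Transport along an equality of *source* places, for a dependent family `x w ∈ L_w` (the
form needed for restricted products): if `w₁ = w₂` then `g (x w₁) = g (x w₂)` in `L_w`. [folklore] -/
theorem galAdicCompletionMap_apply_congr_place {g : G} {w₁ w₂ w : HeightOneSpectrum B}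
    (hw : w₁ = w₂) (h₁ : g • w₁ = w) (h₂ : g • w₂ = w)
    (x : ∀ u : HeightOneSpectrum B, u.adicCompletion L) :
    galAdicCompletionMap (L := L) g h₁ (x w₁) = galAdicCompletionMap g h₂ (x w₂) := by
  subst hw; rfl

/-- `g⁻¹` undoes `g` on completions. [folklore] -/
@[simp] theorem galAdicCompletionMap_inv_apply (g : G) {w w' : HeightOneSpectrum B} (h : g • w = w')
    (h' : g⁻¹ • w' = w) (y : w.adicCompletion L) :
    galAdicCompletionMap g⁻¹ h' (galAdicCompletionMap g h y) = y := by
  rw [galAdicCompletionMap_galAdicCompletionMap,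
    galAdicCompletionMap_congr_left L (inv_mul_cancel g) _ (one_smul G w), galAdicCompletionMap_one]

/-- `g` undoes `g⁻¹` on completions. [folklore] -/
@[simp] theorem galAdicCompletionMap_apply_inv (g : G) {w w' : HeightOneSpectrum B} (h : g • w = w')
    (h' : g⁻¹ • w' = w) (y : w'.adicCompletion L) :
    galAdicCompletionMap g h (galAdicCompletionMap g⁻¹ h' y) = y := by
  rw [galAdicCompletionMap_galAdicCompletionMap,
    galAdicCompletionMap_congr_left L (mul_inv_cancel g) _ (one_smul G w'), galAdicCompletionMap_one]

omit [IsDedekindDomain B] in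
/-- `g • w = w'` rearranged: `g⁻¹ • w' = w`. [folklore] -/
theorem inv_smul_eq_of_smul_eq {g : G} {w w' : HeightOneSpectrum B} (h : g • w = w') :
    g⁻¹ • w' = w := by
  rw [← h, inv_smul_smul]

variable {L} in
/-- **Galois transport of completions as a topological ring isomorphism** `σ_w : L_w ≃+* L_{σ w}`,
with inverse the transport along `σ⁻¹`. [cite: CasselsFrohlichANT1967, Ch. VII §1.1] -/
def galAdicCompletionEquiv (g : G) {w w' : HeightOneSpectrum B} (h : g • w = w') :
    w.adicCompletion L ≃+* w'.adicCompletion L :=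
  RingEquiv.ofRingHom (galAdicCompletionMap g h) (galAdicCompletionMap g⁻¹ (inv_smul_eq_of_smul_eq h))
    (by ext y; simp) (by ext y; simp)

/-- `galAdicCompletionEquiv g h` is `galAdicCompletionMap g h` as a function (definitional).
[folklore] -/
@[simp] theorem coe_galAdicCompletionEquiv (g : G) {w w' : HeightOneSpectrum B} (h : g • w = w') :
    ⇑(galAdicCompletionEquiv (L := L) g h) = galAdicCompletionMap g h := rfl

/-- The inverse of `galAdicCompletionEquiv g` is the transport along `g⁻¹`. [folklore] -/
theorem galAdicCompletionEquiv_symm_apply (g : G) {w w' : HeightOneSpectrum B} (h : g • w = w')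
    (y : w'.adicCompletion L) :
    (galAdicCompletionEquiv (L := L) g h).symm y =
      galAdicCompletionMap g⁻¹ (inv_smul_eq_of_smul_eq h) y := rfl

/-- `galAdicCompletionEquiv` is continuous. [folklore] -/
theorem continuous_galAdicCompletionEquiv (g : G) {w w' : HeightOneSpectrum B} (h : g • w = w') :
    Continuous (galAdicCompletionEquiv (L := L) g h) :=
  continuous_galAdicCompletionMap L g h

/-- The inverse of `galAdicCompletionEquiv` is continuous. [folklore] -/
theorem continuous_galAdicCompletionEquiv_symm (g : G) {w w' : HeightOneSpectrum B}
    (h : g • w = w') : Continuous (galAdicCompletionEquiv (L := L) g h).symm :=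
  continuous_galAdicCompletionMap L g⁻¹ (inv_smul_eq_of_smul_eq h)

variable {L} in
/-- `galAdicCompletionEquiv` as a homeomorphism `L_w ≃ₜ L_{g w}`. [folklore] -/
def galAdicCompletionHomeomorph (g : G) {w w' : HeightOneSpectrum B} (h : g • w = w') :
    w.adicCompletion L ≃ₜ w'.adicCompletion L where
  toEquiv := (galAdicCompletionEquiv (L := L) g h).toEquiv
  continuous_toFun := continuous_galAdicCompletionEquiv L g h
  continuous_invFun := continuous_galAdicCompletionEquiv_symm L g h

variable {L} in
/-- The induced isomorphism of unit groups `L_wˣ ≃* L_{g w}ˣ`. [folklore] -/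
def galAdicCompletionUnitsEquiv (g : G) {w w' : HeightOneSpectrum B} (h : g • w = w') :
    (w.adicCompletion L)ˣ ≃* (w'.adicCompletion L)ˣ :=
  Units.mapEquiv (galAdicCompletionEquiv (L := L) g h).toMulEquiv

/-- The valuation of a transported unit (e.g. a uniformizer stays a uniformizer). [folklore] -/
@[simp] theorem valued_galAdicCompletionUnitsEquiv (g : G) {w w' : HeightOneSpectrum B}
    (h : g • w = w') (u : (w.adicCompletion L)ˣ) :
    Valued.v ((galAdicCompletionUnitsEquiv (L := L) g h u : (w'.adicCompletion L)ˣ) :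
      w'.adicCompletion L) = Valued.v (u : w.adicCompletion L) :=
  valued_galAdicCompletionMap L g h u

end Completion

/-! ### Number fields: `Gal(E/F)` acting on the finite places of `E` -/

section NumberField

open NumberField

variable (F : Type*) [Field F] {E : Type*} [Field E] [NumberField E] [Algebra F E]

omit [NumberField E] in
/-- The action of `σ ∈ Aut(E/F)` on `𝓞 E` is the restriction of `σ` (definitional; Mathlib's
`MulSemiringAction G (𝓞 K)` transported from `integralClosure ℤ K`). [folklore] -/
theorem RingOfIntegers.coe_algEquiv_smul (σ : E ≃ₐ[F] E) (y : 𝓞 E) :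
    ((σ • y : 𝓞 E) : E) = σ (y : E) := rfl

/-- `Aut(E/F)` acts `𝓞 F`-linearly on `𝓞 E`. [folklore] -/
instance instSMulCommClassAlgEquivRingOfIntegers : SMulCommClass (E ≃ₐ[F] E) (𝓞 F) (𝓞 E) where
  smul_comm σ x y := by
    apply RingOfIntegers.ext
    change σ (((algebraMap (𝓞 F) (𝓞 E) x * y : 𝓞 E)) : E) =
      ((algebraMap (𝓞 F) (𝓞 E) x * (σ • y) : 𝓞 E) : E)
    rw [RingOfIntegers.coe_eq_algebraMap, RingOfIntegers.coe_eq_algebraMap, map_mul, map_mul,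
      map_mul]
    congr 1
    exact σ.commutes (x : F)

/-- The action of `Aut(E/F)` on `E` is by `σ • x = σ x` and is compatible with the one on `𝓞 E`
(Mathlib instances `AlgEquiv.applyMulSemiringAction`, `SMulDistribClass G (𝓞 K) K`); recorded as
an `example`. -/
example : SMulDistribClass (E ≃ₐ[F] E) (𝓞 E) E := inferInstance

variable (E) in
/-- **Conjugate places lie over the same place of `F`**: `(σ • w) ∩ 𝓞 F = w ∩ 𝓞 F` for
`σ ∈ Aut(E/F)` ("if `w` is over the prime `v` of `K` so is `σ w`").
[cite: CasselsFrohlichANT1967, Ch. VII §1.1] -/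
theorem HeightOneSpectrum.under_algEquiv_smul [NumberField F] (σ : E ≃ₐ[F] E)
    (w : HeightOneSpectrum (𝓞 E)) : (σ • w).under (𝓞 F) = w.under (𝓞 F) :=
  HeightOneSpectrum.under_smul (𝓞 F) σ w

omit [NumberField E] in
variable (E) in
/-- **Conjugate places have the same residue degree over `F`**: `f(σ w | v) = f(w | v)`
(Mathlib `Ideal.inertiaDeg_smul`). [folklore] -/
theorem HeightOneSpectrum.inertiaDeg_algEquiv_smul (σ : E ≃ₐ[F] E) (w : HeightOneSpectrum (𝓞 E)) :
    (σ • w).asIdeal.inertiaDeg (𝓞 F) = w.asIdeal.inertiaDeg (𝓞 F) :=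
  HeightOneSpectrum.inertiaDeg_smul (𝓞 F) σ w

/-- **Conjugate places have the same residue cardinality** `q_{σ w} = q_w`
(`Ideal.absNorm`, i.e. `#(𝓞 E ⧸ 𝔭)`). [folklore] -/
@[simp] theorem HeightOneSpectrum.absNorm_algEquiv_smul (σ : E ≃ₐ[F] E)
    (w : HeightOneSpectrum (𝓞 E)) : Ideal.absNorm (σ • w).asIdeal = Ideal.absNorm w.asIdeal := by
  rw [Ideal.absNorm_apply, Ideal.absNorm_apply, Submodule.cardQuot_apply, Submodule.cardQuot_apply]
  exact HeightOneSpectrum.card_quotient_smul σ w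

/-- For a Galois extension `E/F`, `Gal(E/F)` acts transitively on the places of `E` above a given
place of `F` (Mathlib `Ideal.exists_smul_eq_of_isGaloisGroup`); Cassels–Fröhlich, Ch. VII, Prop. 1.2 (ii).
[cite: CasselsFrohlichANT1967, Ch. VII Prop. 1.2 (ii)] -/
theorem HeightOneSpectrum.exists_algEquiv_smul_eq [NumberField F] [IsGalois F E]
    {w w' : HeightOneSpectrum (𝓞 E)} (h : w.under (𝓞 F) = w'.under (𝓞 F)) :
    ∃ σ : E ≃ₐ[F] E, σ • w = w' := by
  haveI : w.asIdeal.LiesOver (w.under (𝓞 F)).asIdeal := ⟨rfl⟩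
  haveI : w'.asIdeal.LiesOver (w.under (𝓞 F)).asIdeal := ⟨congrArg HeightOneSpectrum.asIdeal h⟩
  haveI : w'.asIdeal.IsPrime := w'.isPrime
  haveI : w.asIdeal.IsPrime := w.isPrime
  obtain ⟨σ, hσ⟩ := Ideal.exists_smul_eq_of_isGaloisGroup (w.under (𝓞 F)).asIdeal w.asIdeal
    w'.asIdeal (E ≃ₐ[F] E)
  exact ⟨σ, HeightOneSpectrum.ext hσ⟩

/-- The valuation at a conjugate place: `v_{σ w}(σ x) = v_w(x)` for `x ∈ E`. [folklore] -/
theorem HeightOneSpectrum.valuation_algEquiv_smul (σ : E ≃ₐ[F] E) (w : HeightOneSpectrum (𝓞 E))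
    (x : E) : (σ • w).valuation E (σ x) = w.valuation E x :=
  HeightOneSpectrum.valuation_smul E σ w x

/-- `galAdicCompletionMap` for `σ ∈ Aut(E/F)` extends `σ`: on `x ∈ E` it is `σ x`. [folklore] -/
theorem galAdicCompletionMap_coe_algEquiv (σ : E ≃ₐ[F] E) {w w' : HeightOneSpectrum (𝓞 E)}
    (h : σ • w = w') (x : E) :
    galAdicCompletionMap σ h (x : w.adicCompletion E) = ((σ x : E) : w'.adicCompletion E) :=
  galAdicCompletionMap_coe E σ h x

/-- `galAdicCompletionMap` for `σ ∈ Aut(E/F)` fixes `F`: it sends the image of `a ∈ F` in `E_w`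
to its image in `E_{σ w}`. [folklore] -/
theorem galAdicCompletionMap_algebraMap (σ : E ≃ₐ[F] E) {w w' : HeightOneSpectrum (𝓞 E)}
    (h : σ • w = w') (a : F) :
    galAdicCompletionMap σ h ((algebraMap F E a : E) : w.adicCompletion E) =
      ((algebraMap F E a : E) : w'.adicCompletion E) := by
  rw [galAdicCompletionMap_coe_algEquiv, AlgEquiv.commutes]

end NumberField


end Literature.NumberTheory.Automorphic
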